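import Summits.CriticalPhenomena.PercolationContinuityZ3.Theses.PercNonProliferation

/-!
# Sketch — crux `SubpolynomialBlocking` (stmt-CriticalPhenomena-4446), ideator 1, round 1

First-lemma signatures for the idea cards `fkg-gate-calculus` (blocking calculus) and
`thick-annulus-first-moment` (transfer). Everything is stated over existing declarations
(`box`, `innerBoundary`, `zdGraph`, `openConnIn`, `bondPercolation`, `criticalProbI`);
statements only (`def … : Prop`), nothing is proved here.
-/

noncomputable section

namespace Summit.CriticalPhenomena.PercolationContinuityZ3.Cruxes.SubpolynomialBlocking.Sketch

open MeasureTheory Filter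
open Literature.Probability.LatticeModels Literature.Probability.Percolation
open Summit.CriticalPhenomena.PercolationContinuityZ3.Theses.PercNonProliferation

/-- The critical bond measure on `ℤ³`. -/
def μc : Measure (BondConfig (Site 3)) := bondPercolation (zdGraph 3) (criticalProbI 3)

/-- Annulus blocking `Block(m, M)`: no open path inside `B(M)` from `B(m)` to `∂ⁱⁿB(M)`.
The crux's event is `blockAnn n (2 * n)`. -/
def blockAnn (m M : ℕ) : Set (BondConfig (Site 3)) :=
  {ω | ¬ ∃ x ∈ box 3 m, ∃ y ∈ innerBoundary (zdGraph 3) (box 3 M),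
      ω ∈ openConnIn (↑(box 3 M) : Set (Site 3)) x y}

/-- The crux, restated through `blockAnn` (definitionally the route decl). -/
theorem crux_iff :
    SubpolynomialBlocking ↔
      ∀ s : ℝ, 0 < s → ∀ᶠ n : ℕ in atTop, (n : ℝ) ^ (-s) ≤ μc.real (blockAnn n (2 * n)) :=
  Iff.rfl

/-- A coordinate rectangle `[a₀,b₀] × [a₁,b₁] × [a₂,b₂] ⊆ ℤ³`. -/
def rect (a b : Fin 3 → ℤ) : Set (Site 3) := {x | ∀ i, a i ≤ x i ∧ x i ≤ b i}

/-- Directional blocking of a rectangle: no open path INSIDE `rect a b` from its low face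
`{x i = a i}` to its high face `{x i = b i}` in direction `i` ("no crossing in direction `i`";
for `i` the short direction this is the thin-direction blocking `a_n` of the cards). -/
def blockDir (a b : Fin 3 → ℤ) (i : Fin 3) : Set (BondConfig (Site 3)) :=
  {ω | ¬ ∃ x ∈ rect a b, ∃ y ∈ rect a b, x i = a i ∧ y i = b i ∧ ω ∈ openConnIn (rect a b) x y}

/-- The outer slab of the annulus `B(2n) \ B(n)` on the positive side of direction `i`:
`x i ∈ [n, 2n]`, other coordinates in `[-2n, 2n]`; and on the negative side: `x i ∈ [-2n, -n]`. -/
def slabLoPos (n : ℕ) (i : Fin 3) : Fin 3 → ℤ := fun j => if j = i then (n : ℤ) else -(2 * n : ℤ)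
def slabHiPos (n : ℕ) (_i : Fin 3) : Fin 3 → ℤ := fun _ => (2 * n : ℤ)
def slabLoNeg (n : ℕ) (_i : Fin 3) : Fin 3 → ℤ := fun _ => -(2 * n : ℤ)
def slabHiNeg (n : ℕ) (i : Fin 3) : Fin 3 → ℤ := fun j => if j = i then -(n : ℤ) else (2 * n : ℤ)

/-- FIRST LEMMA (a), deterministic "six-slab" inclusion (path chasing, provable now): if each
of the six outer slabs of `B(2n) \ B(n)` (dimensions `(4n+1) × (4n+1) × (n+1)`) has no open
crossing in its thin direction, then the annulus is blocked.  Reason: an open path from `B(n)`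
to `∂ⁱⁿB(2n)` inside `B(2n)` ends on a face `{x i = ±2n}`; after its last visit to
`{|x i| ≤ n}` it crosses the corresponding slab from `{x i = ±n}` to `{x i = ±2n}` inside it. -/
def SixSlabInclusion : Prop :=
  ∀ (n : ℕ) (ω : BondConfig (Site 3)),
    (∀ i : Fin 3, ω ∈ blockDir (slabLoPos n i) (slabHiPos n i) i) →
    (∀ i : Fin 3, ω ∈ blockDir (slabLoNeg n i) (slabHiNeg n i) i) →
      ω ∈ blockAnn n (2 * n)

/-- FIRST LEMMA (b), the converse sandwich (provable now): annulus blocking forces the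
thin-direction blocking of the `(2n+1) × (2n+1) × (n+1)` box `[-n,n]² × [n,2n]` sitting on top
of `B(n)` (its bottom face lies in `B(n)`, its top face in `∂ⁱⁿB(2n)`, and it is inside `B(2n)`;
`openConnIn` is monotone in the vertex set, `openConnIn_mono'`). Hence `u_n ≤ a_n`. -/
def TopBoxInclusion : Prop :=
  ∀ (n : ℕ) (ω : BondConfig (Site 3)), ω ∈ blockAnn n (2 * n) →
    ω ∈ blockDir ![-(n : ℤ), -(n : ℤ), (n : ℤ)] ![(n : ℤ), (n : ℤ), (2 * n : ℤ)] 2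

/-- FIRST LEMMA (c), the FKG step (Harris–FKG for the product measure `setBer`, decreasing
events): `u_n ≥ ∏ P(slab blockings) = P(thin blocking of a 4:4:1 box)^6` by lattice symmetry.
Stated as the product inequality; the six events are decreasing cylinder events. -/
def SixSlabFKG : Prop :=
  ∀ n : ℕ, 1 ≤ n →
    (∏ i : Fin 3, μc.real (blockDir (slabLoPos n i) (slabHiPos n i) i)) *
      (∏ i : Fin 3, μc.real (blockDir (slabLoNeg n i) (slabHiNeg n i) i))
      ≤ μc.real (blockAnn n (2 * n))

/-- The thin-direction blocking probability `b_n` of the `3:3:1` box `[0,3n]² × [0,n]`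
(blocked across its short direction) is subpolynomial — the single-shape avatar the calculus
reduces the crux to: `u_n ≥ b_n^{216}` (six slabs + GATE LEMMA with `t = n`, all gates of
flatness ≤ 3, and monotonicity in the lateral sides) and `b_n ≥ u_{⌊n/5⌋}^{C}` (FOAM: a grid of
`C` translates of `Block(m,2m)`, `m = ⌊n/5⌋`, centred on the mid-plane `z = ⌊n/2⌋`). -/
def ThinBlockingSubpolynomial : Prop :=
  ∀ s : ℝ, 0 < s → ∀ᶠ n : ℕ in atTop,
    (n : ℝ) ^ (-s) ≤ μc.real (blockDir ![0, 0, 0] ![(3 * n : ℤ), (3 * n : ℤ), (n : ℤ)] 2)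

/-- The reduction claimed by card `fkg-gate-calculus` (K1, provable now: ~6 deterministic
gate/foam inclusions + `harris_fkg_lower` + translation/rotation invariance): the crux is
EQUIVALENT to the single-shape statement. -/
def CruxIffThin : Prop := SubpolynomialBlocking ↔ ThinBlockingSubpolynomial

/-- GATE LEMMA (deterministic, provable now): blocking the `z`-direction of a long box follows
from blocking the `z`-direction of overlapping pieces of `x`-length `3t` (offsets `t`) and the
`x`-direction of the `x`-gates of thickness `t` (full `y`- and `z`-extent): a bottom–top open path
either has `x`-range of length `≤ 2t` (then it lies in one piece) or its `x`-range contains a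
full gate `[kt,(k+1)t]`, which it then crosses left–right inside the gate. -/
def GateLemma : Prop :=
  ∀ (L W H t : ℕ) (ω : BondConfig (Site 3)), 1 ≤ t →
    (∀ i : ℕ, i * t ≤ L →
      ω ∈ blockDir ![(i * t : ℤ), 0, 0] ![min ((i + 3) * t : ℤ) L, (W : ℤ), (H : ℤ)] 2) →
    (∀ k : ℕ, (k + 1) * t ≤ L →
      ω ∈ blockDir ![(k * t : ℤ), 0, 0] ![((k + 1) * t : ℤ), (W : ℤ), (H : ℤ)] 0) →
    ω ∈ blockDir ![0, 0, 0] ![(L : ℤ), (W : ℤ), (H : ℤ)] 2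

/-- BLOCKING PROPAGATES UP ONE SCALE-STEP AT POLYNOMIAL COST (provable now from the gate lemma,
the foam inclusion and FKG): `u_n ≥ u_{⌊n/5⌋}^C` for an absolute `C` (the 3D substitute for
"RSW + FKG ⇒ circuits at the next scale"; it does NOT iterate to anything useful — one step). -/
def BlockingPropagatesUp : Prop :=
  ∃ C : ℕ, ∀ n : ℕ, 25 ≤ n →
    μc.real (blockAnn (n / 5) (2 * (n / 5))) ^ C ≤ μc.real (blockAnn n (2 * n))

/-- Thick-annulus blocking at aspect ratio `R`, subpolynomial form. For every FIXED `R ≥ 2`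
this is equivalent to the crux: `⇐` since `blockAnn n (2n) ⊇ blockAnn`-of-thinner is false but
the FOAM inclusion `⋂_{x ∈ grid} Block(x; m, Rm) ⊆ Block(n, 2n)` (grid of `C R²` points on the
sphere of radius `⌊3n/2⌋`, `m = ⌊n/(3R)⌋`) plus FKG gives `u(n,2n) ≥ u(m,Rm)^{C R²}`;
`⇒` since `blockAnn m (2m) ⊆ blockAnn m (R m)`. -/
def ThickBlockingSubpolynomial (R : ℕ) : Prop :=
  ∀ s : ℝ, 0 < s → ∀ᶠ m : ℕ in atTop, (m : ℝ) ^ (-s) ≤ μc.real (blockAnn m (R * m))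

def CruxIffThick : Prop := ∀ R : ℕ, 2 ≤ R → (SubpolynomialBlocking ↔ ThickBlockingSubpolynomial R)

/-- The sup-over-scales crossing function `f(R) = sup_m P(B(m) ↔ ∂ⁱⁿB(Rm) in B(Rm))` is
sub-multiplicative, `f(2 R₁ R₂) ≤ f(R₁) f(R₂)` (independence of the inside of `B(R₁ m)` and the
outside of `B(2 R₁ m)` + a last-exit decomposition), whence the DICHOTOMY: either `f ≡ 1` or
`f(R) ≤ C R^{-a}`; and `X_B` (= `PercAnnulusCrossing.CritAnnulusNonCrossing`, `inf_n u_n > 0`)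
holds iff `f(2) < 1` iff `f(R) < 1` for some `R`. Pointwise form of the sub-multiplicativity: -/
def CrossSubmultiplicative : Prop :=
  ∀ (m R₁ R₂ : ℕ), 1 ≤ m → 1 ≤ R₁ → 1 ≤ R₂ →
    μc.real (blockAnn m (2 * R₁ * R₂ * m))ᶜ ≤
      μc.real (blockAnn m (R₁ * m))ᶜ *
        ⨆ m' : {k : ℕ // 1 ≤ k}, μc.real (blockAnn (m' : ℕ) (R₂ * (m' : ℕ)))ᶜ

/-- TRANSFER target of card `thick-annulus-first-moment` (C⁺, stronger than the crux and than
`X_B`): FIRST-MOMENT NON-PROLIFERATION ACROSS A THICK ANNULUS — for some fixed aspect ratio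
`R₀` the expected number of distinct clusters of `B(R₀ m)` (induced) joining `B(m)` to
`∂ⁱⁿB(R₀ m)` is `≤ η < 1` uniformly in `m` (typed through representatives exactly as the route
types `E[N_n]` in `MeanCauchySchwarz`). Then `P(cross) ≤ E[#] ≤ η`, so `u(m, R₀ m) ≥ 1 - η`,
so `X_B`, so the crux. It isolates the hyperscaling content in ONE number whose `d > 6`
divergence (`E[#] ≍ m^{d-6}`) is the catalogued barrier `SpanningClustersAboveSix`. -/
def FirstMomentThickNonProliferation : Prop :=
  ∃ (R₀ : ℕ) (η : ℝ), 2 ≤ R₀ ∧ η < 1 ∧ ∀ m : ℕ, 1 ≤ m →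
    (∑ k ∈ Finset.range (box 3 m).card,
      μc.real {ω | ∃ x : Fin (k + 1) → Site 3, (∀ i, x i ∈ box 3 m) ∧
        (∀ i, ∃ y ∈ innerBoundary (zdGraph 3) (box 3 (R₀ * m)),
          ω ∈ openConnIn (↑(box 3 (R₀ * m)) : Set (Site 3)) (x i) y) ∧
        ∀ i j, i ≠ j → ω ∉ openConnIn (↑(box 3 (R₀ * m)) : Set (Site 3)) (x i) (x j)}) ≤ η

/-- The transfer implication claimed (provable now from `CruxIffThick`-type foam + Markov). -/
def TransferImplication : Prop := FirstMomentThickNonProliferation → SubpolynomialBlocking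

open Classical in
/-- TRACE CLOSURE (no-entropy modification; provable now): with `T` the set of vertices of
`∂ⁱⁿB(m)` joined to `B(n)` inside `B(m)` (`n < m < 2n - 1`), closing the `≤ 3|T|` edges from
`T` out of `B(m)` blocks the annulus, and those edges are independent of the configuration
inside `B(m)`; hence `u_n ≥ E[(1 - p_c)^{3 |T|}] ≥ (1 - p_c)^{3K} P(|T| ≤ K)`. Stated for the
mid-sphere `m = n + ⌊n/2⌋` and a deterministic level `K`. -/
def TraceClosure : Prop :=
  ∀ (n K : ℕ), 4 ≤ n →
    (1 - (criticalProbI 3 : ℝ)) ^ (3 * K) *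
      μc.real {ω | ((innerBoundary (zdGraph 3) (box 3 (n + n / 2))).filter fun t =>
          ∃ x ∈ box 3 n, ω ∈ openConnIn (↑(box 3 (n + n / 2)) : Set (Site 3)) x t).card ≤ K}
      ≤ μc.real (blockAnn n (2 * n))

end Summit.CriticalPhenomena.PercolationContinuityZ3.Cruxes.SubpolynomialBlocking.Sketch
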